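import Literature.Probability.Entropy.FiniteShannon
import HarnessLib

/-!
# Entropy of windows of a process: the subadditivity chain of Tao's entropy decrement argument

Topic `Literature/Probability/Entropy`.  Everything in this file is PROVED (no named facts); it is
stated in the vocabulary of `Literature.Probability.Entropy.FiniteShannon` (`Literature.FiniteShannon`:
random variables on a finite weighted set `(s, w)`, `ent`, `condEnt`, `mutualInfo`).

In §3 of T. Tao, *The logarithmically averaged Chowla and Elliott conjectures for two-point
correlations* (Forum Math. Pi 4 (2016) e8), the random variable `X_H` is the window
`(W_1, …, W_H)` of a process `(W_j)` (there `W_j = (g_{1,ε²}(a n + j), g_{2,ε²}(a n + j))`), and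
`Y_H` is a further random variable.  From the Shannon inequalities and the *approximate
translation invariance* `𝐇(W_{H₁+1..H₁+H₂} | Y) ≤ 𝐇(W_{1..H₂} | Y) + δ` (which the paper gets
from Lemma 2.5 and "`n + H₁ (mod P_H)` conveys exactly the same information as `n (mod P_H)`")
the paper derives the relative approximate subadditivity and, iterating,
`𝐇(X_{kH} | Y_H) ≤ k 𝐇(X_H | Y_H) + o(1)`, whence the unnumbered display on p. 21 of the
arXiv version (whose quotient by `kH` is display (3.12)):

  `𝐇(X_{kH}) ≤ k 𝐇(X_H) - k 𝐈(X_H : Y_H) + 𝐇(Y_H) + o(1)`.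

This file proves these steps for an arbitrary process on a finite weighted set:

* `window W m H` — the random variable `(W_{m+1}, …, W_{m+H})` (as a list);
  `window_add` — `X_{m, m+H₁+H₂}` is the concatenation of `X_{m, m+H₁}` and `X_{m+H₁, m+H₁+H₂}`;
* `condEnt_window_add_le` — `𝐇(X_{m,m+H₁+H₂} | Y) ≤ 𝐇(X_{m,m+H₁} | Y) + 𝐇(X_{m+H₁,m+H₁+H₂} | Y)`
  ((3.6) for windows: the relative subadditivity of p. 21); `ent_window_add_le` — the
  unconditional version ((3.4) for windows, the exact form of (3.11));
* `condEnt_window_mul_le` — under approximate translation invariance of the blocks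
  `X_{jH,(j+1)H}`, `(j+1)H ≤ H₊`, with error `δ`: `𝐇(X_{kH} | Y) ≤ k 𝐇(X_H | Y) + k δ` for
  `kH ≤ H₊`;
* `ent_window_mul_le` — the display before (3.12):
  `𝐇(X_{kH}) ≤ k (𝐇(X_H) - 𝐈(X_H : Y)) + k δ + 𝐇(Y)`;
* `ent_window_le` — **(3.8)**: `𝐇(X_{m,m+H}) ≤ H · B` if every `𝐇(W_j) ≤ B`.

Together with `Literature.NumberTheory.LFunctions.Tao2016.EntropyDecrement.exists_scale_le` (`TaoEntropyDecrement.lean`, the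
pigeonholing of Lemma 3.2) this is the entropy decrement argument, modulo the inputs `δ = o(1)`
(Lemma 2.5) and `𝐇(Y_H) ≪ H` ((3.10)).

## References
* T. Tao, Forum Math. Pi 4 (2016), e8; arXiv:1509.05422 (numbering of the arXiv version), §3,
  displays (3.8), (3.10)–(3.12) and the unnumbered displays between (3.11) and (3.12) (p. 21).

## Design choices
* Windows are `List α`-valued (no length index in the type), so that `X_{kH}` can be
  manipulated by arithmetic on `k H` without casts; `length_window` records the length.
* Approximate translation invariance is assumed only along multiples of the block length `H`:
  `∀ j, (j+1) H ≤ H₊ → condEnt s w (window W (j H) H) Y ≤ condEnt s w (window W 0 H) Y + δ`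
  (the only instances the iteration uses, and the ones Tao's setting supplies: `X_{m,m+H}` is
  a translate of `X_{0,H}` in the variable `n` when `a ∣ m`, and the scales are multiples of `a`).
-/

open Finset Real

namespace Literature.Probability.Entropy

namespace FiniteShannon

variable {ι α β : Type*}

/-! ### Windows of a process -/

/-- The window `X_{m, m+H} = (W_{m+1}, …, W_{m+H})` of the process `W`, as a list-valued random
variable (Tao 2016, §3: `X_H = X_{0,H}`; `X_{H₁,H₁+H₂}` is introduced between (3.10) and (3.11)).
[cite: TaoFMP2016, §3 (between (3.10) and (3.11))] -/
def window (W : ℕ → ι → α) (m : ℕ) : ℕ → ι → List α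
  | 0 => fun _ => []
  | H + 1 => fun i => window W m H i ++ [W (m + H + 1) i]

/-- The empty window. [folklore] -/
@[simp] theorem window_zero (W : ℕ → ι → α) (m : ℕ) (i : ι) : window W m 0 i = [] := rfl

/-- Unfolding the window one step. [folklore] -/
theorem window_succ (W : ℕ → ι → α) (m H : ℕ) (i : ι) :
    window W m (H + 1) i = window W m H i ++ [W (m + H + 1) i] := rfl

/-- A window of length `H` is a list of length `H`. [folklore] -/
@[simp] theorem length_window (W : ℕ → ι → α) (m H : ℕ) (i : ι) : (window W m H i).length = H := by
  induction H with
  | zero => rfl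
  | succ H ih => rw [window_succ, List.length_append, ih]; rfl

/-- **Concatenation of windows**: `X_{m, m+H₁+H₂} = X_{m, m+H₁} ++ X_{m+H₁, m+H₁+H₂}`
(Tao 2016, §3: "`X_{H₁+H₂}` is the concatenation of `X_{H₁}` and `X_{H₁,H₁+H₂}`").
[cite: TaoFMP2016, §3 (derivation of (3.11))] -/
theorem window_add (W : ℕ → ι → α) (m H₁ H₂ : ℕ) (i : ι) :
    window W m (H₁ + H₂) i = window W m H₁ i ++ window W (m + H₁) H₂ i := by
  induction H₂ with
  | zero => simp
  | succ H₂ ih =>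
    rw [← Nat.add_assoc, window_succ, ih, window_succ, List.append_assoc]
    congr 3
    ring

/-- The window of length `H₁ + H₂` is an injective function of the pair of its two halves.
[folklore] -/
theorem window_add_eq_comp (W : ℕ → ι → α) (m H₁ H₂ : ℕ) :
    window W m (H₁ + H₂) =
      (fun p : List α × List α => p.1 ++ p.2) ∘ fun i => (window W m H₁ i, window W (m + H₁) H₂ i) := by
  funext i
  exact window_add W m H₁ H₂ i

variable [DecidableEq α] [DecidableEq β] {s : Finset ι} {w : ι → ℝ}

/-- Concatenation is injective on pairs of windows (the first components have a fixed length).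
[folklore] -/
theorem injOn_append_window (W : ℕ → ι → α) (m H₁ H₂ : ℕ) :
    Set.InjOn (fun p : List α × List α => p.1 ++ p.2)
      (s.image fun i => (window W m H₁ i, window W (m + H₁) H₂ i)) := by
  intro p hp q hq h
  simp only [Finset.coe_image, Set.mem_image, Finset.mem_coe] at hp hq
  obtain ⟨i, -, rfl⟩ := hp
  obtain ⟨j, -, rfl⟩ := hq
  simp only at h
  have hlen : (window W m H₁ i).length = (window W m H₁ j).length := by simp
  obtain ⟨h1, h2⟩ := List.append_inj h hlen
  exact Prod.ext h1 h2

/-! ### Subadditivity along windows -/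

/-- **Relative subadditivity for windows** (Tao 2016, (3.6) applied to the concatenation; the
exact form of the relative approximate subadditivity of p. 21):
`𝐇(X_{m,m+H₁+H₂} | Y) ≤ 𝐇(X_{m,m+H₁} | Y) + 𝐇(X_{m+H₁,m+H₁+H₂} | Y)`.
[cite: TaoFMP2016, §3 (relative approximate subadditivity, p. 21, from (3.6))] -/
theorem condEnt_window_add_le (hw : ∀ i ∈ s, 0 ≤ w i) (W : ℕ → ι → α) (Y : ι → β)
    (m H₁ H₂ : ℕ) :
    condEnt s w (window W m (H₁ + H₂)) Y ≤
      condEnt s w (window W m H₁) Y + condEnt s w (window W (m + H₁) H₂) Y := by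
  rw [window_add_eq_comp, condEnt_comp_left_of_injOn (injOn_append_window W m H₁ H₂)]
  exact condEnt_pair_le_add hw

/-- **Subadditivity for windows** (Tao 2016, (3.4) applied to the concatenation; the exact form
of the approximate subadditivity (3.11)):
`𝐇(X_{m,m+H₁+H₂}) ≤ 𝐇(X_{m,m+H₁}) + 𝐇(X_{m+H₁,m+H₁+H₂})`. [cite: TaoFMP2016, §3 (3.11)] -/
theorem ent_window_add_le (hw : ∀ i ∈ s, 0 ≤ w i) (W : ℕ → ι → α) (m H₁ H₂ : ℕ) :
    ent s w (window W m (H₁ + H₂)) ≤ ent s w (window W m H₁) + ent s w (window W (m + H₁) H₂) := by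
  rw [window_add_eq_comp, ent_comp_of_injOn (injOn_append_window W m H₁ H₂)]
  exact ent_pair_le_add hw

/-- **(3.8)**: if every coordinate `W_j`, `m < j ≤ m + H`, has entropy at most `B`, the window
`X_{m,m+H}` has entropy at most `H · B`. [cite: TaoFMP2016, (3.8)] -/
theorem ent_window_le (hw : ∀ i ∈ s, 0 ≤ w i) (W : ℕ → ι → α) {B : ℝ} (m H : ℕ)
    (hB : ∀ j, m < j → j ≤ m + H → ent s w (W j) ≤ B) : ent s w (window W m H) ≤ H * B := by
  induction H with
  | zero =>
    -- a constant random variable has entropy `≤ log 1 = 0`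
    have := ent_le_log_card (s := s) (w := w) (X := window W m 0) hw (t := {[]})
      (fun l hl => by
        obtain ⟨i, -, rfl⟩ := Finset.mem_image.1 hl
        simp)
    simpa using this
  | succ H ih =>
    have h1 := ent_window_add_le hw W m H 1
    have h2 : ent s w (window W (m + H) 1) = ent s w (W (m + H + 1)) := by
      have : window W (m + H) 1 = (fun a : α => [a]) ∘ W (m + H + 1) := by
        funext i; rfl
      rw [this, ent_comp_of_injOn]
      intro a _ b _ h
      exact List.singleton_injective h
    rw [h2] at h1
    have h3 := hB (m + H + 1) (by omega) (by omega)
    have h4 := ih fun j hj hj' => hB j hj (by omega)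
    push_cast
    linarith

/-- **Iterated relative approximate subadditivity** (Tao 2016, §3: "Iterating this, we conclude
in particular that `𝐇(X_{kH} | Y_H) ≤ k 𝐇(X_H | Y_H) + o(1)`").  Fix a block length `H`.  If
the conditional entropy of each block `X_{jH,(j+1)H}` with `(j+1)H ≤ H₊` is within `δ` of that of
`X_{0,H}` (approximate translation invariance along multiples of `H` — in the paper this comes
from Lemma 2.5, the window `X_{jH,(j+1)H}` being a translate of `X_{0,H}` in the variable `n`
because `a ∣ H`), then for `k H ≤ H₊`: `𝐇(X_{kH} | Y) ≤ k 𝐇(X_H | Y) + k δ`.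
[cite: TaoFMP2016, §3 (unnumbered display 𝐇(X_{kH}|Y_H) ≤ k𝐇(X_H|Y_H) + o(1), p. 21)] -/
theorem condEnt_window_mul_le (hw : ∀ i ∈ s, 0 ≤ w i) (W : ℕ → ι → α) (Y : ι → β) {δ : ℝ}
    {Hp : ℕ} (H : ℕ) (hTI : ∀ j : ℕ, (j + 1) * H ≤ Hp →
      condEnt s w (window W (j * H) H) Y ≤ condEnt s w (window W 0 H) Y + δ) :
    ∀ k : ℕ, k * H ≤ Hp →
      condEnt s w (window W 0 (k * H)) Y ≤ k * condEnt s w (window W 0 H) Y + k * δ := by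
  intro k
  induction k with
  | zero =>
    intro _
    simp only [Nat.cast_zero, zero_mul, add_zero]
    -- `window W 0 0` is constant, so each fibre entropy is `≤ log 1 = 0`
    rw [condEnt_def]
    refine Finset.sum_nonpos fun b _ => mul_nonpos_iff.2 (Or.inl ⟨prob_nonneg (X := Y) hw b, ?_⟩)
    have := ent_le_log_card (s := s.filter fun i => Y i = b) (w := w) (X := window W 0 0)
      (fun i hi => hw i (Finset.mem_of_mem_filter i hi)) (t := {[]}) (fun l hl => by
        obtain ⟨i, -, rfl⟩ := Finset.mem_image.1 hl
        simp)
    simpa using this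
  | succ k ih =>
    intro hk
    have hk' : k * H ≤ Hp := le_trans (Nat.mul_le_mul_right H (Nat.le_succ k)) hk
    have h1 := condEnt_window_add_le hw W Y 0 (k * H) H
    rw [Nat.zero_add] at h1
    have h2 := hTI k (by rw [Nat.succ_mul] at hk; linarith)
    have h3 := ih hk'
    rw [Nat.succ_mul]
    push_cast
    linarith

/-- **Tao 2016, the entropy decrement inequality** (the unnumbered display before (3.12), i.e.
(3.12) before division by `kH`): under approximate translation invariance of the conditional
block entropies along multiples of `H` with error `δ` up to length `H₊`
(as in `condEnt_window_mul_le`), for `k H ≤ H₊`,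
`𝐇(X_{kH}) ≤ k (𝐇(X_H) - 𝐈(X_H : Y)) + k δ + 𝐇(Y)`.
(`𝐇(X_{kH}) ≤ 𝐇(X_{kH} | Y) + 𝐇(Y)`, then `condEnt_window_mul_le`, then
`𝐇(X_H | Y) = 𝐇(X_H) - 𝐈(X_H : Y)`.)  With `𝐇(Y_H) ≪ H` ((3.10)) this is the decrement
hypothesis of `Literature.NumberTheory.LFunctions.Tao2016.EntropyDecrement.exists_scale_le`.
[cite: TaoFMP2016, §3 (display before (3.12))] -/
theorem ent_window_mul_le (hw : ∀ i ∈ s, 0 ≤ w i) (W : ℕ → ι → α) (Y : ι → β) {δ : ℝ}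
    {Hp : ℕ} (H : ℕ) (hTI : ∀ j : ℕ, (j + 1) * H ≤ Hp →
      condEnt s w (window W (j * H) H) Y ≤ condEnt s w (window W 0 H) Y + δ)
    {k : ℕ} (hk : k * H ≤ Hp) :
    ent s w (window W 0 (k * H)) ≤
      k * (ent s w (window W 0 H) - mutualInfo s w (window W 0 H) Y) + k * δ + ent s w Y := by
  have h1 := ent_le_condEnt_add_ent (X := window W 0 (k * H)) (Y := Y) hw
  have h2 := condEnt_window_mul_le hw W Y H hTI k hk
  have h3 := mutualInfo_eq_ent_sub_condEnt (X := window W 0 H) (Y := Y) hw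
  rw [h3]
  linarith

/-! ### Supplying the translation-invariance hypothesis: continuity of conditional entropy

In the paper the hypothesis of `condEnt_window_mul_le` comes from Lemma 2.5: the joint law of
`(X_{jH,(j+1)H}, Y_H)` is within `o(1)` of that of `(X_{0,H}, Y'_H)` with `Y'_H` a relabelling of
`Y_H` ("`n + H₁ (mod P_H)` conveys exactly the same information as `n (mod P_H)`",
`condEnt_comp_right_of_injOn`), and entropy is continuous in the law. -/

/-- **Conditional entropy is continuous in the joint law.**  If the joint laws of `(X, Y)` and
`(X', Y')` (possibly on different finite weighted sets) are `δ`-close pointwise on a finite set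
`t` containing their values, and the laws of `Y`, `Y'` are `δ`-close on a finite set `u`
containing their values (`δ ≤ 1`), then
`|𝐇(X | Y) - 𝐇(X' | Y')| ≤ (#t + #u) (φ(δ) + δ)` (chain rule and `abs_ent_sub_ent_le` twice).
[folklore] -/
theorem abs_condEnt_sub_condEnt_le {ι' : Type*} {s' : Finset ι'} {w' : ι' → ℝ}
    (hw : ∀ i ∈ s, 0 ≤ w i) (hw' : ∀ i ∈ s', 0 ≤ w' i) (X : ι → α) (Y : ι → β) (X' : ι' → α)
    (Y' : ι' → β) {t : Finset (α × β)} {u : Finset β}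
    (ht : s.image (fun i => (X i, Y i)) ⊆ t) (ht' : s'.image (fun i => (X' i, Y' i)) ⊆ t)
    (hu : s.image Y ⊆ u) (hu' : s'.image Y' ⊆ u) {δ : ℝ} (hδ1 : δ ≤ 1)
    (hXY : ∀ v ∈ t, |prob s w (fun i => (X i, Y i)) v - prob s' w' (fun i => (X' i, Y' i)) v| ≤ δ)
    (hY : ∀ b ∈ u, |prob s w Y b - prob s' w' Y' b| ≤ δ) :
    |condEnt s w X Y - condEnt s' w' X' Y'| ≤ (#t + #u) * (negMulLog δ + δ) := by
  have h1 : condEnt s w X Y = ent s w (fun i => (X i, Y i)) - ent s w Y := by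
    rw [ent_pair_eq_add_condEnt hw]; ring
  have h2 : condEnt s' w' X' Y' = ent s' w' (fun i => (X' i, Y' i)) - ent s' w' Y' := by
    rw [ent_pair_eq_add_condEnt hw']; ring
  have hA := abs_ent_sub_ent_le hw hw' ht ht' hδ1 hXY
  have hB := abs_ent_sub_ent_le hw hw' hu hu' hδ1 hY
  rw [h1, h2, abs_le] at *
  constructor <;> nlinarith [hA.1, hA.2, hB.1, hB.2]

end FiniteShannon

end Literature.Probability.Entropy
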